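import Literature.NumberTheory.EllipticCurves.BurungaleKobayashiNakamuraOta2026.AnticyclotomicRankGrowth
import Literature.NumberTheory.EllipticCurves.RohrlichAnticyclotomicRootNumber
import Literature.NumberTheory.EllipticCurves.RootNumberSignProofs
import Literature.NumberTheory.EllipticCurves.Tamagawa
import Mathlib.Data.Nat.Totient
import HarnessLib

/-!
# Agboola–Howard 2005 (Math. Res. Lett. 12, 611–621; REFEREED), Theorem A and (3.1): the
# `p^∞`-SELMER CORANK of a CM elliptic curve over `ℚ` along the anticyclotomic `ℤ_p`-tower at a
# prime `p > 3` of good SUPERSINGULAR reduction (`p` INERT in the CM field) grows like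
# `Σ_{1 ≤ k ≤ n, (−1)^k = ε} φ(p^k)`, and the root numbers of the anticyclotomic twists ALTERNATE with
# the parity of the layer (Greenberg 1983) — typed STATEMENTS (refereed named facts) + proved corollaries

Topic `NumberTheory/EllipticCurves`, sub-directory `AgboolaHoward2005` (namespace = path). Cross-ladder
literature-typing layer (cell `bsd-littype`, seat 10, generation 4). This is the INERT companion of the
RAMIFIED statements of Burungale–Kobayashi–Nakamura–Ota 2026 typed in
`BurungaleKobayashiNakamuraOta2026/AnticyclotomicRankGrowth.lean` (`thm66_selmerCorank_layer_OPEN`,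
`eqn11_rootNumber_pow_OPEN`; BKNO cite this paper as their reference [1]: "the theory envisioned by
Rubin [29] in the late 1980s and developed after the resolution of his conjecture [6] in 2021 rests on a
pair of Selmer structures at `p` [4, 7–10] (see also [1, 11])", arXiv:2608.06879 p. 3), and it is
written in EXACTLY the same currency (same binders, same dictionary), so that the two can be consumed
side by side. The source here is a PUBLISHED, refereed paper: its statements are named facts
`def … : Prop` with `[cite: AgboolaHoward2005, …]` (D-0014), not claim binders.

## The printed statements (arXiv:math/0401124v2 = MRL 12 (2005); held text `paper:arxiv-math_0401124`,
## file `p000N` = printed page `N`)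

* §1 (p. 1): "Suppose now that `E` has complex multiplication by the maximal order `𝒪` of an imaginary
  quadratic field `K`. Let `ψ` denote the `K`-valued grossencharacter associated to `E`, and write `𝔣`
  for the conductor of `ψ`. Fix once and for all a rational prime `p > 3` at which `E` has good
  reduction, and which is inert in `K`. Then `E` has supersingular reduction at `p`. […] Let `D_∞` be
  the anticyclotomic `ℤ_p` extension of `K`, and let `D_n ⊂ D_∞` be the subfield such that
  `[D_n : K] = p^n`."
* **Theorem A** (p. 2): "Let `φ` be Euler's function and let `ε = ±1` be the sign in the functional
  equation of `L(E/ℚ, s)`. Write `Sel_{p^∞}(E/D_n)` for the `p`-primary Selmer group of `E/D_n`, and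
  `𝒪_p` for the local completion of `𝒪` at `p`. Then there is an integer `e`, independent of `n`, such
  that `corank_{𝒪_p} Sel_{p^∞}(E/D_n) = e + Σ_{1 ≤ k ≤ n, (−1)^k = ε} φ(p^k)` for all `n ≫ 0`."
  ("Our main result, predicted by R. Greenberg [3, p. 247]"; "somewhat more information is contained
  in Theorem 5.4"; p. 10: "Theorem A of the Introduction now follows from the first part of Theorem
  5.4.")
* **(3.1)** (p. 4, proof of Prop. 3.1): "Let `χ` be any primitive character of `Gal(D_n/K)` for
  `n > 0`, and write `W(χψ)` for the root number of `χψ`. The following formula is proved by Greenberg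
  in [3, page 247]: `W(χψ) = (−1)^{n+1} W(ψ)`. (3.1)" — with (p. 4) "`W(ψ)` denote the root number of
  `ψ`. In particular `W(ψ) = ±1` and is equal to the sign in the functional equation of `L(E/ℚ, s)`",
  and Remark 3.2: "The equality (3.1) (which is visibly incorrect when `n = 0`) is the reason for
  placing the trivial character in `Ξ⁻_n`." ([3] = R. Greenberg, *On the Birch and Swinnerton-Dyer
  conjecture*, Invent. Math. 72 (1983) 241–265.)
* Theorem 5.4 (p. 10): "Let `ε` be the sign of `W(ψ)`. There is an integer `e`, independent of `n`,
  such that `corank_{𝒪_p}(Sel(D_n, W)) = rank_{𝒪_p}(Λ/ω^ε_n) + e` for `n ≫ 0`. If Conjecture 3.5 holds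
  then the `𝒪_p`-corank of `Sel(D_n, W)` is equal to `rank_{𝒪_p}(Λ/ω^ε_n) + rank_{𝒪_p}(Y⁺/ω⁺_n Y⁺) +
  rank_{𝒪_p}(Y⁻/ω⁻_n Y⁻)` for all `n`, where `Y^±` is the `Λ`-torsion submodule of `X^±`." (§5 p. 7:
  `ω⁺_n = ∏_{1≤k≤n, k even} Φ_{p^k}(γ)`, `ω⁻_n = (γ − 1) ∏_{1≤k≤n, k odd} Φ_{p^k}(γ)`; Conjecture 3.5 =
  Rubin's conjecture `H¹ = H¹₊ ⊕ H¹₋` [Rubin 1987, Conj. 2.2], since PROVED for `p ≥ 5` by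
  Burungale–Kobayashi–Ota, Ann. of Math. 194 (2021) — see `BurungaleKobayashiOta2024/`.)

## Transcription on the tree's objects (the dictionary; identical to the BKNO sibling file)

* "`E/ℚ` with CM by the maximal order `𝒪` of `K`": `W : WeierstrassCurve ℚ`, elliptic,
  `W.j ∈ maximalCMJInvariants`, `IsCMFieldOfJ K W.j` (`K ≅ ℚ(√d_K)`, `d_K = cmFieldDiscr W.j`).
* "`p > 3` at which `E` has good reduction, inert in `K`": `3 < p`, `W.HasGoodReductionAtPrime p`
  (model-independent, `Tamagawa.lean`), and `p𝒪_K` is a prime ideal — `(Ideal.span {(p : 𝓞 K)}).IsPrime`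
  (the literal meaning of "inert"; the tree's precedent is `HeegnerPointsHeckeOrbit.lean`'s `hinert`).
  (Supersingularity at `p` is then automatic — Deuring — and is not a separate hypothesis in print.)
* "`D_n`": the layer `κ.layer n` of ANY `κ : ZpExtension K p` with `κ.IsAnticyclotomic` (the
  anticyclotomic `ℤ_p`-extension of an imaginary quadratic field is unique; `layer` is twist-invariant,
  `ZpExtension.layer_unitTwist`). "`n ≫ 0`": `∀ᶠ n in Filter.atTop`.
* "`ψ` the grossencharacter associated to `E`" and "`ε` = the sign in the functional equation of
  `L(E/ℚ, s)` = `W(ψ)`": as in the sibling, `ψ` enters through the printed clauses of Deuring's theorem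
  that pin it (`Deuring_exists_heckeCharacter_of_maximalCM`: infinity type `(1,0)`, conj-equivariant for
  the complex conjugation `c ≠ 1` of `K`, `L(E/ℚ, s) = L(s, ψ)` on `re s > 3/2`), and `ε` through the
  tree's weight-two root-number predicate `IsCentralRootNumber ψ ε` (`Λ(s, ψ) = ε Λ(2 − s, ψ)`;
  `RohrlichAnticyclotomicNonvanishing.lean`), `ε : ℤ` cast to `ℂ` (so `ε = ±1`,
  `IsCentralRootNumber.eq_one_or_eq_neg_one`). Since `Λ(E/ℚ, s)` and `Λ(s, ψ)` agree up to the
  constant `B^s`-normalisation, this IS the sign of the functional equation of `L(E/ℚ, s)`.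
* "`corank_{𝒪_p} Sel_{p^∞}(E/D_n)`": `𝒪_p` (the completion of `𝒪_K` at the inert `p`) is free of rank
  `2` over `ℤ_p` and `Sel_{p^∞}(E/D_n)` is an `𝒪_p`-module (the CM endomorphisms are defined over
  `K ⊆ D_n`), so `corank_{𝒪_p} = ½ · corank_{ℤ_p}`; the tree's `WeierstrassCurve.selmerCorank` is the
  `ℤ_p`-corank of the classical `p^∞`-Selmer group (`Selmer.lean`) of the base change to the number
  field `κ.layer n`. So Theorem A is typed DOUBLED: `corank_{ℤ_p} Sel_{p^∞}(E/D_n) = 2e + 2·S_ε(n)`,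
  `e ∈ ℤ` as printed ("an integer `e`"), with `S_ε(n) = Σ_{1 ≤ k ≤ n, (−1)^k = ε} φ(p^k)` the definition
  `signedTotientSum p ε n` below (Mathlib `Nat.totient`). Nothing more.
* "`χ` a primitive character of `Gal(D_n/K)`, `n > 0`": a finite-order character of
  `Γ^{ac} = Gal(D_∞/K)` of level `≤ n` (`BurungaleKobayashiNakamuraOta2026.IsAcCharacter ι κ n χ r`, with
  `p`-adic avatar `r`) that is NOT of level `≤ n − 1` (`r` is non-trivial on `Gal(K̄/D_{n−1})` =
  `κ.layerSubgroup (n − 1)`), `0 < n` — since `Gal(D_n/K)` is cyclic of order `p^n` these are exactly the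
  characters of exact order `p^n`, i.e. the primitive ones; "`W(χψ)`" = the weight-two root number of
  `ψ * χ` (`IsCentralRootNumber (ψ * χ) _`), the reading used by the sibling for BKNO's `ε(φχ)`.
  (3.1) is typed as an implication between the two root-number predicates (root numbers are unique,
  `IsCentralRootNumber.unique`; the existence for `ψχ` — Hecke — rides along: at worst WEAKER).

## What is here

* `signedTotientSum p ε n` — the printed sum `Σ_{1 ≤ k ≤ n, (−1)^k = ε} φ(p^k)` (definition with body)
  with its API: `_zero`, `_succ`, `_mono`, `add_one_le_signedTotientSum_add_two` (it gains at least
  `φ(p^k) ≥ 1` every two steps), `tendsto_signedTotientSum_atTop` (PROVED).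
* `eqn31_rootNumber_layer_inert` — (3.1) = Greenberg 1983 p. 247 (refereed named fact).
* `thmA_selmerCorank_layer_inert` — Theorem A (refereed named fact).
* PROVED corollaries (kernel; the facts enter as hypotheses; 0 further facts):
  `tendsto_selmerCorank_layer_of_thmA` ("the corank of the `p`-Selmer group" is UNBOUNDED along `D_∞`,
  in contrast with the cyclotomic tower, §1 p. 1); `selmerCorank_layer_succ_sub_of_thmA` (the corank
  JUMPS: eventually `corank(D_{n+1}) − corank(D_n) = 2φ(p^{n+1})` if `(−1)^{n+1} = ε` and `0` otherwise —
  the shape re-derived as Burungale–Kobayashi–Ota, J. Inst. Math. Jussieu 23 (2024), Cor. 1.4 /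
  Cor. 4.11, which `BurungaleKobayashiOta2024/SupersingularPConverse.lean` lists as not typed there);
  `tendsto_mordellWeilRank_add_shaCorank_layer_of_thmA` (with the tree's discharged identity
  `corank Sel_{p^∞} = rank + corank Ш[p^∞]`, `selmerCorank_eq_mordellWeilRank_add_holds`:
  `rank_ℤ E(D_n) + corank_{ℤ_p} Ш(E/D_n)[p^∞] → ∞` — Greenberg's 1983 prediction in the form "either
  the Mordell–Weil rank or the Tate–Shafarevich coranks are unbounded in the inert anticyclotomic
  tower"; the Mordell–Weil alternative is the refereed theorem of Li–Xu 2026, `LiXu2026/`);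
  `rootNumber_layer_inert_eq_neg_of_eqn31` ((3.1) read as: at the layers `n > 0` with `(−1)^n = ε` every
  primitive twist has root number `−1`).

## What is NOT here (typed GAP, reasons)

Thm. 5.4 second part, Thm. 3.6, Thm. 4.1–4.3, Prop. 3.3–3.4, Thm. 5.2, Prop. 5.3 (the `Λ`-modules
`X^±, 𝒮^±, ℋ¹_±`, the twisted elliptic-unit module `𝒞`, the Coates–Wiles homomorphism `δ_χ`): the
restricted ± Selmer groups over `D_∞` and the local conditions `E^±(D_{n,𝔭})` are not tree carriers
(the same gap as the BKNO signed Selmer groups, see `SignedSelmerMainIdentity.lean` §"Why an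
interface"; the abstract `±` skeletons of `BurungaleKobayashiOta2024/` and `Sprung2012/` are
interfaces, not constructions). Thm. 5.4 first part carries no information beyond Theorem A in the
typed currency (`rank_{𝒪_p}(Λ/ω^ε_n) = deg ω^ε_n` differs from `S_ε(n)` by the constant `1` when
`ε = −1`, absorbed in `e`). Prop. 3.1 (the image of `𝒞` in `ℋ¹` lies in `ℋ¹_ε`): same carriers.

References: [AgboolaHoward2005] A. Agboola, B. Howard, *Anticyclotomic Iwasawa theory of CM elliptic
curves II*, Math. Res. Lett. 12 (2005), no. 5-6, 611–621 = arXiv:math/0401124v2: §1 and Thm. A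
(pp. 1–2), Prop. 3.1 with (3.1) and Rem. 3.2 (p. 4), §5 (p. 7), Thm. 5.4 (p. 10)
[corpus: paper:arxiv-math_0401124 p0001, p0002, p0004, p0007, p0010]; [Greenberg1983] R. Greenberg,
Invent. Math. 72 (1983), p. 247 (the root-number formula (3.1) and the prediction of Theorem A, as
quoted by Agboola–Howard); [BurungaleKobayashiOta2023] J. Inst. Math. Jussieu 23 (2024), Cor. 1.4 /
Cor. 4.11 (corank jumps); [Greenberg1999] §1 (`corank Sel_{p^∞} = rank + corank Ш[p^∞]`);
[SilvermanATAEC1994] II Thms. 9.2/10.5 (the character `ψ`; tree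
`Deuring_exists_heckeCharacter_of_maximalCM`).
-/

noncomputable section

open scoped Classical
open Filter Finset WeierstrassCurve NumberField IsDedekindDomain
open Literature.NumberTheory.Automorphic Literature.NumberTheory.GaloisRepresentations
open Literature.NumberTheory.EllipticCurves.BurungaleKobayashiNakamuraOta2026 (IsAcCharacter)

namespace Literature.NumberTheory.EllipticCurves.AgboolaHoward2005

/-! ## §0 The printed sum `Σ_{1 ≤ k ≤ n, (−1)^k = ε} φ(p^k)` -/

/-- **The signed totient sum of Theorem A**: `S_ε(n) = Σ_{1 ≤ k ≤ n, (−1)^k = ε} φ(p^k)` (`φ` Euler's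
function, Mathlib `Nat.totient`), for a sign `ε ∈ ℤ` (intended `±1`) — the main term of
`corank_{𝒪_p} Sel_{p^∞}(E/D_n)` in Agboola–Howard's Theorem A. [cite: AgboolaHoward2005, Thm. A (p. 2)] -/
def signedTotientSum (p : ℕ) (ε : ℤ) (n : ℕ) : ℕ :=
  ∑ k ∈ (Icc 1 n).filter (fun k ↦ (-1 : ℤ) ^ k = ε), (p ^ k).totient

/-- `S_ε(0) = 0` (empty sum). [cite: AgboolaHoward2005, Thm. A (p. 2)] -/
theorem signedTotientSum_zero (p : ℕ) (ε : ℤ) : signedTotientSum p ε 0 = 0 := by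
  simp [signedTotientSum]

/-- The recursion `S_ε(n+1) = S_ε(n) + [(-1)^{n+1} = ε] φ(p^{n+1})`. [cite: AgboolaHoward2005, Thm. A (p. 2)] -/
theorem signedTotientSum_succ (p : ℕ) (ε : ℤ) (n : ℕ) :
    signedTotientSum p ε (n + 1) =
      signedTotientSum p ε n + if (-1 : ℤ) ^ (n + 1) = ε then (p ^ (n + 1)).totient else 0 := by
  unfold signedTotientSum
  have hIcc : Icc 1 (n + 1) = insert (n + 1) (Icc 1 n) := by
    ext k; simp only [mem_Icc, mem_insert]; omega
  have hnot : n + 1 ∉ Icc 1 n := by simp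
  rw [hIcc, filter_insert]
  split_ifs with h
  · rw [sum_insert (fun hm ↦ hnot (mem_filter.mp hm).1), add_comm]
  · simp

/-- `S_ε` is monotone in `n`. [cite: AgboolaHoward2005, Thm. A (p. 2)] -/
theorem signedTotientSum_mono (p : ℕ) (ε : ℤ) : Monotone (signedTotientSum p ε) := by
  refine monotone_nat_of_le_succ fun n ↦ ?_
  rw [signedTotientSum_succ]
  exact Nat.le_add_right _ _

/-- Every two steps the sum gains a term: for `ε = ±1` and `p ≥ 1`,
`S_ε(n) + 1 ≤ S_ε(n + 2)` (one of `k = n+1, n+2` has `(−1)^k = ε`, and `φ(p^k) ≥ 1`).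
[cite: AgboolaHoward2005, Thm. A (p. 2)] -/
theorem add_one_le_signedTotientSum_add_two {p : ℕ} (hp : 0 < p) {ε : ℤ} (hε : ε = 1 ∨ ε = -1)
    (n : ℕ) : signedTotientSum p ε n + 1 ≤ signedTotientSum p ε (n + 2) := by
  have htot : ∀ k : ℕ, 1 ≤ (p ^ k).totient := fun k ↦ Nat.totient_pos.mpr (pow_pos hp k)
  rw [signedTotientSum_succ, signedTotientSum_succ]
  by_cases h1 : (-1 : ℤ) ^ (n + 1) = ε
  · rw [if_pos h1]
    have := htot (n + 1)
    split_ifs <;> omega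
  · have h2 : (-1 : ℤ) ^ (n + 1 + 1) = ε := by
      rw [pow_succ]
      rcases hε with rfl | rfl
      · rcases neg_one_pow_eq_or ℤ (n + 1) with h | h
        · exact absurd h h1
        · rw [h]; norm_num
      · rcases neg_one_pow_eq_or ℤ (n + 1) with h | h
        · rw [h]; norm_num
        · exact absurd h h1
    rw [if_neg h1, if_pos h2]
    have := htot (n + 1 + 1)
    omega

/-- `S_ε(n) → ∞` for `ε = ±1`, `p ≥ 1`. [cite: AgboolaHoward2005, Thm. A (p. 2)] -/
theorem tendsto_signedTotientSum_atTop {p : ℕ} (hp : 0 < p) {ε : ℤ} (hε : ε = 1 ∨ ε = -1) :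
    Tendsto (signedTotientSum p ε) atTop atTop := by
  -- `n/2 ≤ S_ε(n)`-type lower bound: `m ≤ S_ε(2m)`
  have hlow : ∀ m : ℕ, m ≤ signedTotientSum p ε (2 * m) := by
    intro m
    induction m with
    | zero => simp
    | succ m ih =>
      have h := add_one_le_signedTotientSum_add_two hp hε (2 * m)
      have h2 : 2 * (m + 1) = 2 * m + 2 := by ring
      rw [h2]
      omega
  refine tendsto_atTop_atTop.mpr fun b ↦ ⟨2 * b, fun n hn ↦ ?_⟩
  calc b ≤ signedTotientSum p ε (2 * b) := hlow b
    _ ≤ signedTotientSum p ε n := signedTotientSum_mono p ε hn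

/-! ## §1 The two printed statements, for `E/ℚ` (refereed named facts; nothing proved here) -/

/-- **Agboola–Howard 2005, (3.1) (= Greenberg 1983, p. 247): along the INERT anticyclotomic tower
the root numbers of the primitive twists alternate with the parity of the layer** — "Let `χ` be any
primitive character of `Gal(D_n/K)` for `n > 0`, and write `W(χψ)` for the root number of `χψ`. The
following formula is proved by Greenberg in [3, page 247]: `W(χψ) = (−1)^{n+1} W(ψ)`" (p. 4; standing
hypotheses of §1 p. 1: `E/ℚ` with CM by the maximal order `𝒪` of `K`, `ψ` its grossencharacter,
`p > 3` a prime of good reduction inert in `K`, `D_n` the `n`-th layer of the anticyclotomic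
`ℤ_p`-extension of `K`). Transcription (module docstring): the CM frame `W.j ∈ maximalCMJInvariants`,
`IsCMFieldOfJ K W.j`, complex conjugation `c ≠ 1`; `ψ` a Hecke character of `K` of infinity type
`(1,0)`, conj-equivariant, with `L(E/ℚ,s) = L(s,ψ)` on `re s > 3/2` (Deuring's clauses); `3 < p`,
`W.HasGoodReductionAtPrime p`, `p𝒪_K` prime; `κ` an (the) anticyclotomic `ℤ_p`-extension of `K`;
`χ` a finite-order character of `Γ^{ac}` of level `≤ n` (`IsAcCharacter ι κ n χ r`) and NOT of level
`≤ n − 1` (its avatar `r` is non-trivial on `Gal(K̄/D_{n−1}) = κ.layerSubgroup (n−1)`), `0 < n` — a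
primitive character of the cyclic group `Gal(D_n/K)`; root numbers in the weight-two normalisation
(`IsCentralRootNumber`). Conclusion: `W(ψ) = w ⟹ W(ψχ) = (−1)^{n+1} w`. REFEREED (MRL 12 (2005));
the formula itself is Greenberg's (Invent. Math. 72 (1983), p. 247, via Weil's formula
`W(χ₁χ₂) = W(χ₁)W(χ₂)χ₁(𝔣₂)χ₂(𝔣₁)` for coprime conductors). No `_holds` (local root numbers of Hecke
characters are not in the tree).
[cite: AgboolaHoward2005, (3.1) and Rem. 3.2 (p. 4)] [cite: Greenberg1983, p. 247] -/
def eqn31_rootNumber_layer_inert : Prop :=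
  ∀ (W : WeierstrassCurve ℚ) [W.IsElliptic], W.j ∈ maximalCMJInvariants →
    ∀ (K : Type) [Field K] [NumberField K], IsCMFieldOfJ K W.j → ∀ (c : K ≃ₐ[ℚ] K), c ≠ 1 →
      ∀ (ψ : HeckeCharacter K), ψ.HasInfinityType (fun _ ↦ 1) (fun _ ↦ 0) →
        IsHeckeConjEquivariant c ψ → (∀ s : ℂ, 3 / 2 < s.re → heckeLFunction ψ s = W.LSeries s) →
      ∀ (p : ℕ) [Fact p.Prime], 3 < p → W.HasGoodReductionAtPrime p →
        (Ideal.span {(p : 𝓞 K)}).IsPrime →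
        ∀ (κ : ZpExtension K p), κ.IsAnticyclotomic →
        ∀ (ι : PadicAlgCl p ≃+* ℂ) (n : ℕ) (χ : HeckeCharacter K)
          (r : FramedGaloisRep K (PadicAlgCl p) 1), IsAcCharacter ι κ n χ r → 0 < n →
          (∃ σ ∈ κ.layerSubgroup (n - 1), avatarValueAt r σ ≠ 1) →
          ∀ (w : ℂ), IsCentralRootNumber ψ w → IsCentralRootNumber (ψ * χ) ((-1) ^ (n + 1) * w)

/-- **Agboola–Howard 2005, Theorem A: the `p^∞`-Selmer corank over the layers of the INERT
anticyclotomic tower is `e + Σ_{1 ≤ k ≤ n, (−1)^k = ε} φ(p^k)` for `n ≫ 0`** (p. 2): "Let `φ` be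
Euler's function and let `ε = ±1` be the sign in the functional equation of `L(E/ℚ, s)`. Write
`Sel_{p^∞}(E/D_n)` for the `p`-primary Selmer group of `E/D_n`, and `𝒪_p` for the local completion of
`𝒪` at `p`. Then there is an integer `e`, independent of `n`, such that
`corank_{𝒪_p} Sel_{p^∞}(E/D_n) = e + Σ_{1 ≤ k ≤ n, (−1)^k = ε} φ(p^k)` for all `n ≫ 0`." ("predicted by
R. Greenberg [3, p. 247]"; standing hypotheses of §1 p. 1 as in `eqn31_rootNumber_layer_inert`.)
Transcription (module docstring): the frame of `eqn31_rootNumber_layer_inert`; `ε : ℤ` with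
`IsCentralRootNumber ψ ε` (the sign of the functional equation of `L(E/ℚ, s) = L(s, ψ)`; `ε = ±1` by
`IsCentralRootNumber.eq_one_or_eq_neg_one`); `corank_{𝒪_p} = ½ corank_{ℤ_p}`, so in the tree's
`WeierstrassCurve.selmerCorank` of the base change to `κ.layer n`, cast to `ℤ`:
`∃ e ∈ ℤ, ∀ᶠ n, corank_{ℤ_p} Sel_{p^∞}(E/D_n) = 2e + 2·S_ε(n)` with `S_ε = signedTotientSum p ε` — the
printed display doubled, nothing more. REFEREED (MRL 12 (2005); proof: twisted elliptic units, Rubin's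
two-variable main theorem (Invent. Math. 103), the ± Selmer groups and the control theorem Thm. 5.2 — none of these
carriers is in the tree, so no `_holds`). [cite: AgboolaHoward2005, Thm. A (p. 2) and Thm. 5.4 (p. 10)]
[cite: Greenberg1983, p. 247 (the prediction)] -/
def thmA_selmerCorank_layer_inert : Prop :=
  ∀ (W : WeierstrassCurve ℚ) [W.IsElliptic], W.j ∈ maximalCMJInvariants →
    ∀ (K : Type) [Field K] [NumberField K], IsCMFieldOfJ K W.j → ∀ (c : K ≃ₐ[ℚ] K), c ≠ 1 →
      ∀ (ψ : HeckeCharacter K), ψ.HasInfinityType (fun _ ↦ 1) (fun _ ↦ 0) →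
        IsHeckeConjEquivariant c ψ → (∀ s : ℂ, 3 / 2 < s.re → heckeLFunction ψ s = W.LSeries s) →
      ∀ (ε : ℤ), IsCentralRootNumber ψ ε →
      ∀ (p : ℕ) [Fact p.Prime], 3 < p → W.HasGoodReductionAtPrime p →
        (Ideal.span {(p : 𝓞 K)}).IsPrime →
        ∀ (κ : ZpExtension K p), κ.IsAnticyclotomic →
          ∃ e : ℤ, ∀ᶠ n : ℕ in atTop,
            ((W.baseChange (κ.layer n)).selmerCorank p : ℤ) = 2 * e + 2 * (signedTotientSum p ε n : ℤ)

/-! ## §2 Proved corollaries (kernel; the facts enter as hypotheses; 0 new facts) -/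

/-- Plumbing: a Hecke `L`-function agreeing with `L(E/ℚ, s)` on `re s > 3/2` is not identically zero
there (`WeierstrassCurve.exists_LSeries_ofReal_ne_zero`: `L(E, x) → 1` as `x → +∞`). [folklore] -/
private theorem exists_heckeLFunction_ne_zero {K : Type} [Field K] [NumberField K]
    (W : WeierstrassCurve ℚ) (ψ : HeckeCharacter K)
    (hL : ∀ s : ℂ, 3 / 2 < s.re → heckeLFunction ψ s = W.LSeries s) :
    ∃ s : ℂ, 3 / 2 < s.re ∧ heckeLFunction ψ s ≠ 0 := by
  obtain ⟨x, hx, hne⟩ := W.exists_LSeries_ofReal_ne_zero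
  have hx' : (3 / 2 : ℝ) < (x : ℂ).re := by simpa using hx
  exact ⟨x, hx', by rwa [hL x hx']⟩

/-- Plumbing: the sign `ε ∈ ℤ` of `L(E/ℚ, s) = L(s, ψ)` is `±1`
(`IsCentralRootNumber.eq_one_or_eq_neg_one`). [folklore] -/
private theorem sign_eq_one_or_eq_neg_one {K : Type} [Field K] [NumberField K]
    (W : WeierstrassCurve ℚ) (ψ : HeckeCharacter K)
    (hL : ∀ s : ℂ, 3 / 2 < s.re → heckeLFunction ψ s = W.LSeries s)
    {ε : ℤ} (hε : IsCentralRootNumber ψ ε) : ε = 1 ∨ ε = -1 := by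
  rcases hε.eq_one_or_eq_neg_one (exists_heckeLFunction_ne_zero W ψ hL) with h | h
  · left; exact_mod_cast h
  · right; exact_mod_cast h

section Corollaries

variable (W : WeierstrassCurve ℚ) [W.IsElliptic] (hj : W.j ∈ maximalCMJInvariants)
  (K : Type) [Field K] [NumberField K] (hK : IsCMFieldOfJ K W.j) (c : K ≃ₐ[ℚ] K) (hc : c ≠ 1)
  (ψ : HeckeCharacter K) (hψ : ψ.HasInfinityType (fun _ ↦ 1) (fun _ ↦ 0))
  (heq : IsHeckeConjEquivariant c ψ) (hL : ∀ s : ℂ, 3 / 2 < s.re → heckeLFunction ψ s = W.LSeries s)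
  (ε : ℤ) (hε : IsCentralRootNumber ψ ε)
  (p : ℕ) [Fact p.Prime] (hp : 3 < p) (hgood : W.HasGoodReductionAtPrime p)
  (hinert : (Ideal.span {(p : 𝓞 K)}).IsPrime) (κ : ZpExtension K p) (hκ : κ.IsAnticyclotomic)

include hj hK hc hψ heq hL hε hp hgood hinert hκ

/-- **"the corank of the `p`-Selmer group" is UNBOUNDED along the inert anticyclotomic tower** (in
contrast with the cyclotomic `ℤ_p`-extension, §1 p. 1: "the corank of the `p`-Selmer group remains
bounded as one ascends the cyclotomic `ℤ_p`-extension"): granted Theorem A (hypothesis `hA`),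
`corank_{ℤ_p} Sel_{p^∞}(E/D_n) → ∞`. PROVED (`ε = ±1` by `IsCentralRootNumber.eq_one_or_eq_neg_one`,
and `S_ε(n) → ∞`). [cite: AgboolaHoward2005, Thm. A (p. 2) and §1 (p. 1)] -/
theorem tendsto_selmerCorank_layer_of_thmA (hA : thmA_selmerCorank_layer_inert) :
    Tendsto (fun n : ℕ ↦ ((W.baseChange (κ.layer n)).selmerCorank p : ℤ)) atTop atTop := by
  obtain ⟨e, he⟩ := hA W hj K hK c hc ψ hψ heq hL ε hε p hp hgood hinert κ hκ
  have hε1 : ε = 1 ∨ ε = -1 := sign_eq_one_or_eq_neg_one W ψ hL hε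
  have hS := tendsto_signedTotientSum_atTop (Fact.out : p.Prime).pos hε1
  have hS' : Tendsto (fun n : ℕ ↦ 2 * e + 2 * (signedTotientSum p ε n : ℤ)) atTop atTop := by
    have h1 : Tendsto (fun n : ℕ ↦ (signedTotientSum p ε n : ℤ)) atTop atTop :=
      tendsto_natCast_atTop_atTop.comp hS
    have h2 : Tendsto (fun n : ℕ ↦ 2 * (signedTotientSum p ε n : ℤ)) atTop atTop :=
      h1.const_mul_atTop' (by norm_num)
    exact tendsto_atTop_add_const_left _ _ h2
  exact hS'.congr' (he.mono fun n hn ↦ hn.symm)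

/-- **The corank JUMPS between consecutive layers** (granted Theorem A): for `n ≫ 0`,
`corank_{ℤ_p} Sel_{p^∞}(E/D_{n+1}) − corank_{ℤ_p} Sel_{p^∞}(E/D_n) = 2φ(p^{n+1})` if `(−1)^{n+1} = ε`,
and `= 0` otherwise — the printed sum read step by step (the shape "corank jumps
`ε_n p^{n−1}(p−1)`" re-derived by Burungale–Kobayashi–Ota, JIMJ 23 (2024), Cor. 1.4 / Cor. 4.11, doubled).
PROVED from the recursion `signedTotientSum_succ`. [cite: AgboolaHoward2005, Thm. A (p. 2)] -/
theorem selmerCorank_layer_succ_sub_of_thmA (hA : thmA_selmerCorank_layer_inert) :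
    ∀ᶠ n : ℕ in atTop,
      ((W.baseChange (κ.layer (n + 1))).selmerCorank p : ℤ) - ((W.baseChange (κ.layer n)).selmerCorank p : ℤ)
        = if (-1 : ℤ) ^ (n + 1) = ε then 2 * ((p ^ (n + 1)).totient : ℤ) else 0 := by
  obtain ⟨e, he⟩ := hA W hj K hK c hc ψ hψ heq hL ε hε p hp hgood hinert κ hκ
  have he' : ∀ᶠ n : ℕ in atTop,
      ((W.baseChange (κ.layer (n + 1))).selmerCorank p : ℤ) =
        2 * e + 2 * (signedTotientSum p ε (n + 1) : ℤ) :=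
    (tendsto_add_atTop_nat 1).eventually he
  filter_upwards [he, he'] with n hn hn1
  rw [hn, hn1, signedTotientSum_succ]
  split_ifs with h
  · push_cast; ring
  · push_cast; ring

/-- **Greenberg's dichotomy in the inert tower** (granted Theorem A): by the tree's discharged identity
`corank_{ℤ_p} Sel_{p^∞}(E/F) = rank_ℤ E(F) + corank_{ℤ_p} Ш(E/F)[p^∞]`
(`WeierstrassCurve.selmerCorank_eq_mordellWeilRank_add_holds`, [Greenberg1999] §1) over each layer,
`rank_ℤ E(D_n) + corank_{ℤ_p} Ш(E/D_n)[p^∞] → ∞`: either the Mordell–Weil ranks or the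
Tate–Shafarevich coranks are unbounded along `D_∞/K` (the Mordell–Weil alternative holds: Li–Xu, J.
Number Theory (2026), Thm. 1, `LiXu2026/`). PROVED. [cite: AgboolaHoward2005, Thm. A (p. 2)]
[cite: Greenberg1999, §1 (corank identity)] -/
theorem tendsto_mordellWeilRank_add_shaCorank_layer_of_thmA (hA : thmA_selmerCorank_layer_inert) :
    Tendsto (fun n : ℕ ↦ ((W.baseChange (κ.layer n)).mordellWeilRank : ℤ) +
      ((W.baseChange (κ.layer n)).shaCorank p : ℤ)) atTop atTop := by
  have h := tendsto_selmerCorank_layer_of_thmA W hj K hK c hc ψ hψ heq hL ε hε p hp hgood hinert κ hκ hA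
  refine h.congr fun n ↦ ?_
  exact_mod_cast (W.baseChange (κ.layer n)).selmerCorank_eq_mordellWeilRank_add_holds p

end Corollaries

/-- **(3.1) read at the "vanishing" layers**: granted (3.1) (hypothesis `h31`), at every layer `n > 0`
with `(−1)^n = W(ψ)` each primitive twist `ψχ` has root number `−1` (so, by the functional equation,
`L(χψ, 1) = 0` — "If `(−1)^n = W(ψ)`, the functional equation of `L(E/ℚ, s)` forces `L(χψ, 1) = 0`",
p. 4; combine with `RohrlichDichotomy` for the simple zero). PROVED (`(−1)^{n+1}·(−1)^n = −1`).
[cite: AgboolaHoward2005, (3.1) and proof of Prop. 3.1 (p. 4)] -/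
theorem rootNumber_layer_inert_eq_neg_of_eqn31 (h31 : eqn31_rootNumber_layer_inert)
    (W : WeierstrassCurve ℚ) [W.IsElliptic] (hj : W.j ∈ maximalCMJInvariants)
    (K : Type) [Field K] [NumberField K] (hK : IsCMFieldOfJ K W.j) (c : K ≃ₐ[ℚ] K) (hc : c ≠ 1)
    (ψ : HeckeCharacter K) (hψ : ψ.HasInfinityType (fun _ ↦ 1) (fun _ ↦ 0))
    (heq : IsHeckeConjEquivariant c ψ) (hL : ∀ s : ℂ, 3 / 2 < s.re → heckeLFunction ψ s = W.LSeries s)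
    (p : ℕ) [Fact p.Prime] (hp : 3 < p) (hgood : W.HasGoodReductionAtPrime p)
    (hinert : (Ideal.span {(p : 𝓞 K)}).IsPrime) (κ : ZpExtension K p) (hκ : κ.IsAnticyclotomic)
    (ι : PadicAlgCl p ≃+* ℂ) (n : ℕ) (χ : HeckeCharacter K) (r : FramedGaloisRep K (PadicAlgCl p) 1)
    (hχ : IsAcCharacter ι κ n χ r) (hn : 0 < n) (hprim : ∃ σ ∈ κ.layerSubgroup (n - 1), avatarValueAt r σ ≠ 1)
    (w : ℤ) (hw : IsCentralRootNumber ψ w) (hsign : (-1 : ℤ) ^ n = w) :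
    IsCentralRootNumber (ψ * χ) (-1) := by
  have h := h31 W hj K hK c hc ψ hψ heq hL p hp hgood hinert κ hκ ι n χ r hχ hn hprim w hw
  have hval : ((-1 : ℂ) ^ (n + 1) * (w : ℂ)) = -1 := by
    rw [← hsign]; push_cast; rw [← pow_add]
    calc (-1 : ℂ) ^ (n + 1 + n) = (-1) ^ (2 * n + 1) := by ring_nf
      _ = -1 := by rw [pow_succ, pow_mul]; norm_num
  rwa [hval] at h

end Literature.NumberTheory.EllipticCurves.AgboolaHoward2005
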